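import Summits.MatrixMultiplication.MatrixMultiplication.Theorems.FarEdgeDescentSquareGerm
import HarnessLib

/-!
# Route `FarEdgeDescent` — THE CURVATURE LAW of the square–cube pencil, I: the slope function and the dictionary
(lens-2 «special vs generic», gen 26; support module, def-free)

The cut of record `ω(ℂ) = 2 ⟺ FiniteSaturation ∧ AnchoredLogConvexity` (`FarEdgeDescentChord.node_iff`, deciding
theorem `Theses.FarEdgeDescent.closes`) is UNCHANGED.  Gens 21–25 read the failure `ω(ℂ) > 2` of the convex
profile `f(x) := ω(1,x,1)` (tree `omegaRect ℂ 1 x 1`) at three sites — the near vertex `α`, the square `1`, the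
first far zero `β` — through one-sided slopes and corners.  This file names the single object behind all of
them: the SLOPE FUNCTION `σ(x) := ∂⁺f(x)` (`derivWithin f (Ioi x) x`, which exists everywhere because `f` is
convex on `ℝ`, `FarEdgeDescentNearVertex.profile_convexOn_univ`).  It is the distribution function of a
probability law on the shape axis — the CURVATURE LAW `μ := f″` read as a measure — and the lineage's leaves are
statements about that law:

* §1 `σ` is non-decreasing, `0 ≤ σ ≤ 1`, `σ = 0` exactly to the left of `α` (`rightDeriv_eq_zero_of_lt_alpha`,
  `rightDeriv_pos_of_alpha_lt`: the dual exponent is the bottom of the support of `μ`), and `σ(x) → 1`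
  (`tendsto_rightDeriv_atTop`, with the explicit rates `1 − (ω−2)/(x−1) ≤ σ(x)` and `1 − e(k)/(x−k) ≤ σ(x)`):
  TOTAL TURNING ONE — `μ` is a probability measure on `[α, ∞)`.  Left/right slopes interlace
  (`rightDeriv_le_leftDeriv_of_lt`), so any two corners share one unit of turning (`jump_add_jump_le_one`; at
  `α` and `1`: `κ₀ ≤ p`, the near corner and the square corner are paid from the same unit).
* §2 DICTIONARY.  `σ(k) = 1 ⟺ e(k) = 0` at EVERY real shape (`rightDeriv_eq_one_iff`; `⇒` uses the landed
  `LogRate`, `e → 0`), so the special leaf reads `FiniteSaturation ⟺ ∃ k ≥ 2, σ(k) = 1` — the curvature law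
  has COMPACT SUPPORT — and the summit reads `ω = 2 ⟺ σ = 𝟙_{[1,∞)}` (`mm_iff_rightDeriv_heaviside`): the law
  is the DIRAC MASS AT THE SQUARE; equivalently no turning strictly left of the square
  (`mm_iff_rightDeriv_eq_zero_below`), equivalently a full unit jump at the square (`mm_iff_square_jump_eq_one`).
  A shape is an atom of `μ` iff `f` has a corner there (`differentiableAt_iff_leftDeriv_eq_rightDeriv`); the
  aside `SmoothProfile` (stmt-MatrixMultiplication-27850) = «no atoms beyond the square» (`smoothProfile_iff_noJump`).

In this language every special rung (`LogRate`, `SubLogRate`, `PowerAmortisation`, `SuperExpContact`,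
`SuperFactorialContact`, `FiniteSaturation`) is a TAIL CLASS of `μ` and every generic leaf
(`AnchoredLogConvexity`, its relaxations) a heavy-tail shape condition, which is why each lineage cut is «light
tail ∧ heavy tail ⟹ point mass»; the companion module `FarEdgeDescentBarycentreLaw` proves the AREA LAWS
(`ω − 2 = ∫₀¹ σ`, `∫₀^∞ (1 − σ) = 1`: the barycentre of the law is the square, so the point mass sits at `1`) and
places the new rung «integrable excess» (finite second moment) between `FiniteSaturation` and `PowerAmortisation`.

All statements are over `omegaRect ℂ`, `omega ℂ`, `dualExponentAlpha ℂ`, `_root_.MatrixMultiplication` and the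
route decls; no `def`s; imports only landed modules.  Nothing here proves `ω = 2`.
[cite: LottiRomani1983, §2 (p. 174)] [cite: HuangPan1998, §2 eq. (2.5)–(2.8)] [cite: Rockafellar1970, Thm. 24.1,
Thm. 24.2] [cite: CoppersmithWinograd1990, §6]
-/

set_option linter.dupNamespace false

noncomputable section

namespace Summit.MatrixMultiplication.MatrixMultiplication.Theorems.FarEdgeDescentCurvatureLaw

open Literature.Computability.AlgebraicComplexity
open Summit.MatrixMultiplication.MatrixMultiplication.Theses.FarEdgeDescent
  (FiniteSaturation PowerAmortisation SmoothProfile)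
open Summit.MatrixMultiplication.MatrixMultiplication.Theorems.FarEdgeDescentNearVertex
  (profile_convexOn_univ mem_interior_univ hasRightDerivAt hasLeftDerivAt rightDeriv_le_slope
    profile_eq_two_of_le_alpha two_lt_profile_of_alpha_lt)
open Summit.MatrixMultiplication.MatrixMultiplication.Theorems.FarEdgeDescentChord
  (excess_antitone saturated_of_omega_eq_two)
open Summit.MatrixMultiplication.MatrixMultiplication.Theorems.FarEdgeDescentTameProfile (exists_nat_excess_lt)
open Summit.MatrixMultiplication.MatrixMultiplication.Theorems.FarEdgeDescentSquareGerm
  (mm_iff_rightDeriv_eq_one mm_iff_leftDeriv_eq_zero)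
open Filter Topology Set

/-! ## §1 The slope function `σ = ∂⁺f`: distribution function of the curvature law -/

/-- `σ(x) = ∂⁺f(x)` is non-decreasing on `ℝ` (convexity on the whole line). -/
theorem rightDeriv_mono :
    Monotone (fun x : ℝ => derivWithin (fun y : ℝ => omegaRect ℂ 1 y 1) (Ioi x) x) := by
  intro x y hxy
  exact profile_convexOn_univ.monotoneOn_rightDeriv (mem_interior_univ x) (mem_interior_univ y) hxy

/-- `∂⁻f` is non-decreasing on `ℝ`. -/
theorem leftDeriv_mono :
    Monotone (fun x : ℝ => derivWithin (fun y : ℝ => omegaRect ℂ 1 y 1) (Iio x) x) := by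
  intro x y hxy
  exact profile_convexOn_univ.monotoneOn_leftDeriv (mem_interior_univ x) (mem_interior_univ y) hxy

/-- `∂⁻f(x) ≤ ∂⁺f(x)` at every real shape (the jump of `σ` at `x` — the atom of the curvature law — is `≥ 0`). -/
theorem leftDeriv_le_rightDeriv (x : ℝ) :
    derivWithin (fun y : ℝ => omegaRect ℂ 1 y 1) (Iio x) x ≤
      derivWithin (fun y : ℝ => omegaRect ℂ 1 y 1) (Ioi x) x :=
  profile_convexOn_univ.leftDeriv_le_rightDeriv_of_mem_interior (mem_interior_univ x)

/-- INTERLACING: `∂⁺f(x) ≤ ∂⁻f(y)` for `x < y` (both are squeezed by the secant slope over `[x, y]`). -/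
theorem rightDeriv_le_leftDeriv_of_lt {x y : ℝ} (hxy : x < y) :
    derivWithin (fun y : ℝ => omegaRect ℂ 1 y 1) (Ioi x) x ≤
      derivWithin (fun y : ℝ => omegaRect ℂ 1 y 1) (Iio y) y :=
  (rightDeriv_le_slope hxy).trans
    (profile_convexOn_univ.slope_le_leftDeriv_of_mem_interior (mem_univ x) (mem_interior_univ y) hxy)

/-- `0 ≤ ∂⁻f(x)` (the profile is monotone). -/
theorem leftDeriv_nonneg (x : ℝ) : 0 ≤ derivWithin (fun y : ℝ => omegaRect ℂ 1 y 1) (Iio x) x := by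
  have h := profile_convexOn_univ.slope_le_leftDeriv_of_mem_interior (x := x - 1) (y := x)
    (mem_univ _) (mem_interior_univ x) (by linarith)
  have hm : omegaRect ℂ 1 (x - 1) 1 ≤ omegaRect ℂ 1 x 1 := omegaRect_one_mid_one_mono ℂ (by linarith)
  rw [slope_def_field, show x - (x - 1) = 1 by ring, div_one] at h
  linarith

/-- `0 ≤ σ(x)`. -/
theorem rightDeriv_nonneg (x : ℝ) : 0 ≤ derivWithin (fun y : ℝ => omegaRect ℂ 1 y 1) (Ioi x) x :=
  (leftDeriv_nonneg x).trans (leftDeriv_le_rightDeriv x)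

/-- `σ(x) ≤ 1` (one padding step `f(x+1) ≤ f(x) + 1`). -/
theorem rightDeriv_le_one (x : ℝ) : derivWithin (fun y : ℝ => omegaRect ℂ 1 y 1) (Ioi x) x ≤ 1 := by
  have h := rightDeriv_le_slope (b := x) (y := x + 1) (by linarith)
  have hpad := omegaRect_one_mid_one_le_add ℂ (p := x + 1) (q := x) (by linarith)
  rw [slope_def_field, show x + 1 - x = 1 by ring, div_one] at h
  linarith

/-- `∂⁻f(x) ≤ 1`. -/
theorem leftDeriv_le_one (x : ℝ) : derivWithin (fun y : ℝ => omegaRect ℂ 1 y 1) (Iio x) x ≤ 1 :=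
  (leftDeriv_le_rightDeriv x).trans (rightDeriv_le_one x)

/-- NO TURNING LEFT OF THE DUAL EXPONENT: `σ(x) = 0` for `x < α` (`f ≡ 2` on `(-∞, α]`). -/
theorem rightDeriv_eq_zero_of_lt_alpha {x : ℝ} (hx : x < dualExponentAlpha ℂ) :
    derivWithin (fun y : ℝ => omegaRect ℂ 1 y 1) (Ioi x) x = 0 := by
  have h : HasDerivWithinAt (fun y : ℝ => omegaRect ℂ 1 y 1) 0 (Ioi x) x := by
    refine (hasDerivWithinAt_const x (Ioi x) (2 : ℝ)).congr_of_eventuallyEq ?_ ?_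
    · filter_upwards [Ioo_mem_nhdsGT hx] with y hy
      exact profile_eq_two_of_le_alpha hy.2.le
    · exact profile_eq_two_of_le_alpha hx.le
  exact h.derivWithin (uniqueDiffWithinAt_Ioi x)

/-- … and POSITIVE TURNING right of it: `σ(x) > 0` for `x > α` (`f(x) > 2 = f(α)` and the secant from `α`
supports from below).  So `α` is the bottom of the support of the curvature law. -/
theorem rightDeriv_pos_of_alpha_lt {x : ℝ} (hx : dualExponentAlpha ℂ < x) :
    0 < derivWithin (fun y : ℝ => omegaRect ℂ 1 y 1) (Ioi x) x := by
  have h := profile_convexOn_univ.slope_le_leftDeriv_of_mem_interior (x := dualExponentAlpha ℂ) (y := x)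
    (mem_univ _) (mem_interior_univ x) hx
  rw [slope_def_field, omegaRect_dualExponentAlpha] at h
  have h2 := two_lt_profile_of_alpha_lt hx
  have hpos : 0 < (omegaRect ℂ 1 x 1 - 2) / (x - dualExponentAlpha ℂ) := div_pos (by linarith) (by linarith)
  linarith [leftDeriv_le_rightDeriv x]

/-- The near corner is paid before the square: `κ₀ = σ(α) ≤ ∂⁻f(1) = p` whenever `α < 1`. -/
theorem rightDeriv_alpha_le_leftDeriv_one (hα : dualExponentAlpha ℂ < 1) :
    derivWithin (fun y : ℝ => omegaRect ℂ 1 y 1) (Ioi (dualExponentAlpha ℂ)) (dualExponentAlpha ℂ) ≤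
      derivWithin (fun y : ℝ => omegaRect ℂ 1 y 1) (Iio 1) 1 :=
  rightDeriv_le_leftDeriv_of_lt hα

/-- ONE UNIT OF TURNING: the jumps of `σ` at any two shapes `a < b` add up to at most `1`
(in particular `κ₀ + (q − p) ≤ 1`: the near corner at `α` and the corner at the square share one unit). -/
theorem jump_add_jump_le_one {a b : ℝ} (hab : a < b) :
    (derivWithin (fun y : ℝ => omegaRect ℂ 1 y 1) (Ioi a) a -
        derivWithin (fun y : ℝ => omegaRect ℂ 1 y 1) (Iio a) a) +
      (derivWithin (fun y : ℝ => omegaRect ℂ 1 y 1) (Ioi b) b -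
        derivWithin (fun y : ℝ => omegaRect ℂ 1 y 1) (Iio b) b) ≤ 1 := by
  linarith [rightDeriv_le_leftDeriv_of_lt hab, leftDeriv_nonneg a, rightDeriv_le_one b]

/-- RATE FROM THE SQUARE: `1 − (ω − 2)/(x − 1) ≤ ∂⁻f(x)` for `x > 1` (the secant from the square has slope
`(f(x) − ω)/(x − 1) ≥ (x + 1 − ω)/(x − 1)`). -/
theorem one_sub_div_le_leftDeriv {x : ℝ} (hx : 1 < x) :
    1 - (omega ℂ - 2) / (x - 1) ≤ derivWithin (fun y : ℝ => omegaRect ℂ 1 y 1) (Iio x) x := by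
  have h := profile_convexOn_univ.slope_le_leftDeriv_of_mem_interior (x := 1) (y := x)
    (mem_univ _) (mem_interior_univ x) hx
  rw [slope_def_field, omegaRect_one_one_one] at h
  have hlb := add_one_le_omegaRect_one_mid_one ℂ x
  have hx1 : 0 < x - 1 := sub_pos.2 hx
  have hre : 1 - (omega ℂ - 2) / (x - 1) = (x + 1 - omega ℂ) / (x - 1) := by
    field_simp
    ring
  rw [hre]
  exact le_trans (div_le_div_of_nonneg_right (by linarith) hx1.le) h

/-- `1 − (ω − 2)/(x − 1) ≤ σ(x)` for `x > 1`. -/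
theorem one_sub_div_le_rightDeriv {x : ℝ} (hx : 1 < x) :
    1 - (omega ℂ - 2) / (x - 1) ≤ derivWithin (fun y : ℝ => omegaRect ℂ 1 y 1) (Ioi x) x :=
  (one_sub_div_le_leftDeriv hx).trans (leftDeriv_le_rightDeriv x)

/-- DEFICIT LAW from any base shape: `1 − e(k)/(x − k) ≤ σ(x)` for `k < x` (secant from `k`; with the landed
`LogRate` at `k ≈ x/2` the slope deficit `1 − σ(x)` decays like `1/(x log x)`). -/
theorem one_sub_excess_div_le_rightDeriv {k x : ℝ} (hkx : k < x) :
    1 - (omegaRect ℂ 1 k 1 - (k + 1)) / (x - k) ≤ derivWithin (fun y : ℝ => omegaRect ℂ 1 y 1) (Ioi x) x := by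
  have h := profile_convexOn_univ.slope_le_leftDeriv_of_mem_interior (x := k) (y := x)
    (mem_univ _) (mem_interior_univ x) hkx
  rw [slope_def_field] at h
  have hlb := add_one_le_omegaRect_one_mid_one ℂ x
  have hx1 : 0 < x - k := sub_pos.2 hkx
  have hre : 1 - (omegaRect ℂ 1 k 1 - (k + 1)) / (x - k) = (x + 1 - omegaRect ℂ 1 k 1) / (x - k) := by
    field_simp
    ring
  rw [hre]
  exact le_trans (le_trans (div_le_div_of_nonneg_right (by linarith) hx1.le) h) (leftDeriv_le_rightDeriv x)

/-- ★ **TOTAL TURNING ONE.**  `σ(x) → 1` as `x → ∞`: together with `σ = 0` left of `α`, the slope function is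
the distribution function of a PROBABILITY law on `[α, ∞)` — the curvature law `μ = f″`. -/
theorem tendsto_rightDeriv_atTop :
    Tendsto (fun x : ℝ => derivWithin (fun y : ℝ => omegaRect ℂ 1 y 1) (Ioi x) x) atTop (𝓝 1) := by
  have h1 : Tendsto (fun x : ℝ => x - 1) atTop atTop :=
    tendsto_atTop_atTop.2 fun b => ⟨b + 1, fun a ha => by linarith⟩
  have h2 : Tendsto (fun x : ℝ => 1 - (omega ℂ - 2) / (x - 1)) atTop (𝓝 1) := by
    have h := (tendsto_const_nhds (x := omega ℂ - 2) (f := (atTop : Filter ℝ))).div_atTop h1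
    simpa using (tendsto_const_nhds (x := (1 : ℝ)) (f := (atTop : Filter ℝ))).sub h
  refine tendsto_of_tendsto_of_tendsto_of_le_of_le' h2 tendsto_const_nhds ?_ ?_
  · filter_upwards [eventually_gt_atTop 1] with x hx using one_sub_div_le_rightDeriv hx
  · exact Eventually.of_forall rightDeriv_le_one

/-- `∂⁻f(x) → 1` as well. -/
theorem tendsto_leftDeriv_atTop :
    Tendsto (fun x : ℝ => derivWithin (fun y : ℝ => omegaRect ℂ 1 y 1) (Iio x) x) atTop (𝓝 1) := by
  have h1 : Tendsto (fun x : ℝ => x - 1) atTop atTop :=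
    tendsto_atTop_atTop.2 fun b => ⟨b + 1, fun a ha => by linarith⟩
  have h2 : Tendsto (fun x : ℝ => 1 - (omega ℂ - 2) / (x - 1)) atTop (𝓝 1) := by
    have h := (tendsto_const_nhds (x := omega ℂ - 2) (f := (atTop : Filter ℝ))).div_atTop h1
    simpa using (tendsto_const_nhds (x := (1 : ℝ)) (f := (atTop : Filter ℝ))).sub h
  refine tendsto_of_tendsto_of_tendsto_of_le_of_le' h2 tendsto_const_nhds ?_ ?_
  · filter_upwards [eventually_gt_atTop 1] with x hx using one_sub_div_le_leftDeriv hx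
  · exact Eventually.of_forall leftDeriv_le_one

/-! ## §2 Dictionary: saturation = the law's support ends, the summit = Dirac mass at the square, atoms = corners -/

/-- ★ **`σ(k) = 1 ⟺ e(k) = 0`** at every real shape `k`.  (`⇐`: above a saturated shape the profile is pinned to
`x + 1` by the information bound and one padding step.  `⇒`: slope `1` at `k` makes `e` non-decreasing beyond `k`,
and `e → 0` by the landed `LogRate`.) -/
theorem rightDeriv_eq_one_iff (k : ℝ) :
    derivWithin (fun y : ℝ => omegaRect ℂ 1 y 1) (Ioi k) k = 1 ↔ omegaRect ℂ 1 k 1 = k + 1 := by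
  constructor
  · intro h1
    have hsup : ∀ y : ℝ, k < y → omegaRect ℂ 1 k 1 + (y - k) ≤ omegaRect ℂ 1 y 1 := by
      intro y hy
      have h := rightDeriv_le_slope (b := k) (y := y) hy
      rw [h1, slope_def_field, le_div_iff₀ (sub_pos.2 hy)] at h
      linarith
    have hlb := add_one_le_omegaRect_one_mid_one ℂ k
    by_contra hne
    have hpos : 0 < omegaRect ℂ 1 k 1 - (k + 1) :=
      lt_of_le_of_ne (by linarith) (fun h => hne (by linarith))
    obtain ⟨n, hnB, -, hn⟩ := exists_nat_excess_lt hpos (k + 1)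
    have hkn : k < n := by linarith
    have := hsup n hkn
    linarith
  · intro hs
    have h : HasDerivWithinAt (fun y : ℝ => omegaRect ℂ 1 y 1) 1 (Ioi k) k := by
      have hlin : HasDerivWithinAt (fun y : ℝ => y + 1) 1 (Ioi k) k :=
        ((hasDerivAt_id k).add_const (1 : ℝ)).hasDerivWithinAt
      refine hlin.congr_of_eventuallyEq ?_ ?_
      · filter_upwards [self_mem_nhdsWithin] with y hy
        have hup := omegaRect_one_mid_one_le_add ℂ (p := y) (q := k) (le_of_lt hy)
        have hlo := add_one_le_omegaRect_one_mid_one ℂ y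
        show omegaRect ℂ 1 y 1 = y + 1
        linarith
      · simpa using hs
    exact h.derivWithin (uniqueDiffWithinAt_Ioi k)

/-- The SPECIAL LEAF in the law's language: `FiniteSaturation ⟺` the slope function reaches `1` at an integer
shape `k ≥ 2` — the curvature law has COMPACT SUPPORT. -/
theorem finiteSaturation_iff_rightDeriv_eq_one :
    FiniteSaturation ↔ ∃ k : ℕ, 2 ≤ k ∧ derivWithin (fun y : ℝ => omegaRect ℂ 1 y 1) (Ioi (k : ℝ)) k = 1 := by
  constructor
  · rintro ⟨k, hk, hs⟩
    exact ⟨k, hk, (rightDeriv_eq_one_iff (k : ℝ)).2 hs⟩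
  · rintro ⟨k, hk, hs⟩
    exact ⟨k, hk, (rightDeriv_eq_one_iff (k : ℝ)).1 hs⟩

/-- ★ **THE SUMMIT IS THE DIRAC MASS AT THE SQUARE**: `ω(ℂ) = 2 ⟺ σ = 𝟙_{[1,∞)}` (no turning before the square,
all of it at the square). -/
theorem mm_iff_rightDeriv_heaviside :
    _root_.MatrixMultiplication ↔
      ∀ x : ℝ, derivWithin (fun y : ℝ => omegaRect ℂ 1 y 1) (Ioi x) x = if x < 1 then 0 else 1 := by
  constructor
  · intro hS x
    have hω : omega ℂ = 2 := by rwa [_root_.MatrixMultiplication_iff] at hS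
    have hα : dualExponentAlpha ℂ = 1 := (dualExponentAlpha_eq_one_iff ℂ).2 hω
    split_ifs with hx
    · exact rightDeriv_eq_zero_of_lt_alpha (by rwa [hα])
    · exact (rightDeriv_eq_one_iff x).2 (saturated_of_omega_eq_two hω (not_lt.1 hx))
  · intro h
    have h1 := h 1
    simp only [lt_self_iff_false, if_false] at h1
    exact mm_iff_rightDeriv_eq_one.2 h1

/-- The summit as «no turning strictly left of the square»: `ω(ℂ) = 2 ⟺ σ(x) = 0` for every `x < 1`
(`⇐`: zero right derivative on `[0,1)` makes `f` constant on `[0,1]`, so `ω = f(1) = f(0) = 2`). -/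
theorem mm_iff_rightDeriv_eq_zero_below :
    _root_.MatrixMultiplication ↔
      ∀ x : ℝ, x < 1 → derivWithin (fun y : ℝ => omegaRect ℂ 1 y 1) (Ioi x) x = 0 := by
  constructor
  · intro hS x hx
    have h := (mm_iff_rightDeriv_heaviside.1 hS) x
    simpa [hx] using h
  · intro h
    have hderiv : ∀ x ∈ Ico (0 : ℝ) 1,
        HasDerivWithinAt (fun y : ℝ => omegaRect ℂ 1 y 1) 0 (Ici x) x := by
      intro x hx
      have hd := hasRightDerivAt x
      rw [h x hx.2] at hd
      exact hasDerivWithinAt_Ioi_iff_Ici.1 hd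
    have hconst := constant_of_has_deriv_right_zero
      ((continuous_omegaRect_one_mid_one ℂ).continuousOn (s := Icc (0 : ℝ) 1)) hderiv
    have h1 := hconst 1 ⟨zero_le_one, le_rfl⟩
    rw [omegaRect_one_one_one, omegaRect_one_zero_one] at h1
    exact (_root_.MatrixMultiplication_iff).2 h1

/-- THE UNIT ATOM: `ω(ℂ) = 2 ⟺` the jump of `σ` at the square is a full unit, `q − p = 1` (then `q = 1`, `p = 0`:
the whole curvature law is one atom of mass one at the square). -/
theorem mm_iff_square_jump_eq_one :
    _root_.MatrixMultiplication ↔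
      derivWithin (fun y : ℝ => omegaRect ℂ 1 y 1) (Ioi 1) 1 -
        derivWithin (fun y : ℝ => omegaRect ℂ 1 y 1) (Iio 1) 1 = 1 := by
  constructor
  · intro hS
    have hq := mm_iff_rightDeriv_eq_one.1 hS
    have hp := mm_iff_leftDeriv_eq_zero.1 hS
    rw [hq, hp, sub_zero]
  · intro h
    have hq := rightDeriv_le_one 1
    have hp := leftDeriv_nonneg 1
    exact mm_iff_rightDeriv_eq_one.2 (by linarith)

/-- ATOMS = CORNERS: `f` is differentiable at `x` iff `∂⁻f(x) = ∂⁺f(x)` (no jump of `σ`, no atom of `μ`, at `x`). -/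
theorem differentiableAt_iff_leftDeriv_eq_rightDeriv (x : ℝ) :
    DifferentiableAt ℝ (fun y : ℝ => omegaRect ℂ 1 y 1) x ↔
      derivWithin (fun y : ℝ => omegaRect ℂ 1 y 1) (Iio x) x =
        derivWithin (fun y : ℝ => omegaRect ℂ 1 y 1) (Ioi x) x := by
  constructor
  · intro hd
    have h := hd.hasDerivAt
    rw [h.hasDerivWithinAt.derivWithin (uniqueDiffWithinAt_Iio x),
      h.hasDerivWithinAt.derivWithin (uniqueDiffWithinAt_Ioi x)]
  · intro heq
    have hl := hasLeftDerivAt x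
    have hr := hasRightDerivAt x
    rw [heq] at hl
    have h : HasDerivAt (fun y : ℝ => omegaRect ℂ 1 y 1)
        (derivWithin (fun y : ℝ => omegaRect ℂ 1 y 1) (Ioi x) x) x := by
      rw [hasDerivAt_iff_tendsto_slope, ← nhdsLT_sup_nhdsGT]
      exact ((hasDerivWithinAt_iff_tendsto_slope' self_notMem_Iio).1 hl).sup
        ((hasDerivWithinAt_iff_tendsto_slope' self_notMem_Ioi).1 hr)
    exact h.differentiableAt

/-- The aside `SmoothProfile` (stmt-MatrixMultiplication-27850) in the law's language: no atom of the curvature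
law strictly beyond the square. -/
theorem smoothProfile_iff_noJump :
    SmoothProfile ↔ ∀ x : ℝ, 1 < x →
      derivWithin (fun y : ℝ => omegaRect ℂ 1 y 1) (Iio x) x =
        derivWithin (fun y : ℝ => omegaRect ℂ 1 y 1) (Ioi x) x := by
  constructor
  · intro h x hx
    exact (differentiableAt_iff_leftDeriv_eq_rightDeriv x).1 (h x hx)
  · intro h x hx
    exact (differentiableAt_iff_leftDeriv_eq_rightDeriv x).2 (h x hx)

end Summit.MatrixMultiplication.MatrixMultiplication.Theorems.FarEdgeDescentCurvatureLaw

end
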